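import Summits.Parity.GeneralizedHardyLittlewood.Theorems.GreenTaoLevelTwoGITwoCyclicInverseBohrLattice

/-!
# Route `GreenTaoLevelTwo`, crux `GITwo` (stmt-Parity-21275), line `birth`, stub `stub_cyclicInverse`:
# a locally additive map on a Bohr set is linear in the progression coordinates (GT08a §10)

Fifty-eighth helper file toward the XL stub `stub_cyclicInverse` (B. Green, T. Tao, *An inverse
theorem for the Gowers `U³(G)` norm*, arXiv:math/0503014, Thm. 68 = PEMS 51 (2008) Thm. 12.8).
Block D15 (arXiv §10, Lemma 52 / Prop. 54 in the special case the `ℤ/Nℤ` argument needs): the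
frequency map `M` produced by §9 is ADDITIVE on a Bohr set `B(ξ,ρ₀)` (arXiv Prop. 43), and the
final phase is `x ↦ M(x)·x/N`.  With the generators `vⱼ ∈ ℤ/Nℤ`, `wⱼ ∈ ℤᵈ` (`wⱼ ≡ vⱼ ξ`) of
`…BohrLattice`, additivity along the path `0 → c₀v₀ → c₀v₀ + c₁v₁ → …` (one generator at a time,
every partial sum staying inside `B(ξ,ρ₀)` because `∑ⱼ |cⱼ| |w_{jl}| < ρ₀ N`) gives
`M(∑ⱼ cⱼ vⱼ) = ∑ⱼ cⱼ M(vⱼ)` — the "locally linear ⇒ linear in the coordinates `lⱼ`" step of the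
proof of arXiv Lemma 52, for the progression `(−L,L)·v` inside the Bohr set.

* `norm_toAddCircle_intCast_le` — `‖toAddCircle(k mod N)‖ ≤ |k|/N`;
* `sum_coords_mul_eq`, `norm_toAddCircle_sum_coords_le` — `(∑ cⱼvⱼ)·ξ_l ≡ ∑ cⱼ w_{jl}`, hence
  `‖(∑ cⱼ vⱼ) ξ_l / N‖ ≤ (∑ⱼ |cⱼ| |w_{jl}|)/N`;
* `map_sum_coords_eq_of_additive` — the statement above.

References: [GreenTao2008U3Inverse] arXiv:math/0503014, §10 (proof of Lemma 52).
-/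

noncomputable section

namespace Summit.Parity.GeneralizedHardyLittlewood.GreenTaoLevelTwoGITwoCyclicInverse

open Finset

variable {N : ℕ} [NeZero N] {d : ℕ}

/-- `‖toAddCircle (k mod N)‖ ≤ |k| / N` for every integer `k`. [folklore] -/
theorem norm_toAddCircle_intCast_le (k : ℤ) :
    ‖ZMod.toAddCircle ((k : ℤ) : ZMod N)‖ ≤ |(k : ℝ)| / N := by
  rw [ZMod.toAddCircle_intCast, UnitAddCircle.norm_eq]
  have h := round_le ((k : ℝ) / N) 0
  rw [Int.cast_zero, sub_zero, abs_div, Nat.abs_cast] at h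
  exact h

omit [NeZero N] in
/-- In `ℤ/Nℤ`: `(∑ⱼ cⱼ vⱼ) · ξ_l = ∑ⱼ cⱼ w_{jl} (mod N)` when `wⱼ ≡ vⱼ ξ (mod N)`. [folklore] -/
theorem sum_coords_mul_eq (ξ : Fin d → ZMod N) {w : Fin d → Fin d → ℤ} {v : Fin d → ZMod N}
    (hv : ∀ j l, ((w j l : ℤ) : ZMod N) = v j * ξ l) (c : Fin d → ℤ) (l : Fin d) :
    (∑ j, (c j : ZMod N) * v j) * ξ l = ((∑ j, c j * w j l : ℤ) : ZMod N) := by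
  rw [Int.cast_sum, Finset.sum_mul]
  refine Finset.sum_congr rfl fun j _ => ?_
  rw [Int.cast_mul, hv j l, mul_assoc]

/-- Bohr norms of a combination of the generators: `‖(∑ⱼ cⱼ vⱼ) ξ_l / N‖ ≤ (∑ⱼ |cⱼ| |w_{jl}|)/N`.
[cite: GreenTao2008U3Inverse, §10 (proof of Lemma 49, "`(-L,L)·w` is contained in `B`")] -/
theorem norm_toAddCircle_sum_coords_le (ξ : Fin d → ZMod N) {w : Fin d → Fin d → ℤ}
    {v : Fin d → ZMod N} (hv : ∀ j l, ((w j l : ℤ) : ZMod N) = v j * ξ l) (c : Fin d → ℤ)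
    (l : Fin d) :
    ‖ZMod.toAddCircle ((∑ j, (c j : ZMod N) * v j) * ξ l)‖ ≤
      (∑ j, |(c j : ℝ)| * |(w j l : ℝ)|) / N := by
  rw [sum_coords_mul_eq ξ hv c l]
  refine (norm_toAddCircle_intCast_le _).trans ?_
  have hN : (0 : ℝ) ≤ N := Nat.cast_nonneg _
  refine div_le_div_of_nonneg_right ?_ hN
  rw [Int.cast_sum]
  refine (abs_sum_le_sum_abs _ _).trans (le_of_eq ?_)
  exact Finset.sum_congr rfl fun j _ => by rw [Int.cast_mul, abs_mul]

/-- **A locally additive map is linear in the progression coordinates (GT08a §10, proof of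
Lemma 52).**  Let `μ : ℤ/Nℤ → ℤ/Nℤ` be additive on the Bohr set `B(ξ,ρ₀)` (`ρ₀ > 0`):
`μ(a+b) = μ a + μ b` whenever `a, b, a+b ∈ B(ξ,ρ₀)`.  Let `wⱼ ≡ vⱼ ξ (mod N)` and let
`c ∈ ℤᵈ` with `∑ⱼ |cⱼ| |w_{jl}| < ρ₀ N` for every `l`.  Then `μ(∑ⱼ cⱼ vⱼ) = ∑ⱼ cⱼ μ(vⱼ)`.
[cite: GreenTao2008U3Inverse, §10 (proof of Lemma 52)] -/
theorem map_sum_coords_eq_of_additive (ξ : Fin d → ZMod N) {w : Fin d → Fin d → ℤ}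
    {v : Fin d → ZMod N} (hv : ∀ j l, ((w j l : ℤ) : ZMod N) = v j * ξ l) {ρ₀ : ℝ} (hρ₀ : 0 < ρ₀)
    (μ : ZMod N → ZMod N)
    (hadd : ∀ a b : ZMod N, (∀ l, ‖ZMod.toAddCircle (a * ξ l)‖ < ρ₀) →
      (∀ l, ‖ZMod.toAddCircle (b * ξ l)‖ < ρ₀) →
      (∀ l, ‖ZMod.toAddCircle ((a + b) * ξ l)‖ < ρ₀) → μ (a + b) = μ a + μ b)
    (c : Fin d → ℤ) (hc : ∀ l, (∑ j, |(c j : ℝ)| * |(w j l : ℝ)|) < ρ₀ * N) :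
    μ (∑ j, (c j : ZMod N) * v j) = ∑ j, (c j : ZMod N) * μ (v j) := by
  classical
  have hNpos : (0 : ℝ) < N := by exact_mod_cast Nat.pos_of_ne_zero (NeZero.ne N)
  -- `μ 0 = 0`
  have h0 : ∀ l, ‖ZMod.toAddCircle ((0 : ZMod N) * ξ l)‖ < ρ₀ := fun l => by
    rw [zero_mul, map_zero, norm_zero]; exact hρ₀
  have hμ0 : μ 0 = 0 := by
    have h := hadd 0 0 h0 h0 (by rw [add_zero]; exact h0)
    rw [add_zero] at h
    -- `μ 0 = μ 0 + μ 0`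
    have : μ 0 + μ 0 = μ 0 + 0 := by rw [add_zero]; exact h.symm
    exact add_left_cancel this
  -- Bohr membership of a combination from the weight bound
  have hmem : ∀ c' : Fin d → ℤ, (∀ l, (∑ j, |(c' j : ℝ)| * |(w j l : ℝ)|) < ρ₀ * N) →
      ∀ l, ‖ZMod.toAddCircle ((∑ j, (c' j : ZMod N) * v j) * ξ l)‖ < ρ₀ := by
    intro c' hc' l
    refine (norm_toAddCircle_sum_coords_le ξ hv c' l).trans_lt ?_
    rw [div_lt_iff₀ hNpos]; exact hc' l
  -- induction on `n ≥ ∑ⱼ |cⱼ|`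
  have key : ∀ (n : ℕ) (c' : Fin d → ℤ), (∑ j, |c' j|) ≤ n →
      (∀ l, (∑ j, |(c' j : ℝ)| * |(w j l : ℝ)|) < ρ₀ * N) →
      μ (∑ j, (c' j : ZMod N) * v j) = ∑ j, (c' j : ZMod N) * μ (v j) := by
    intro n
    induction n with
    | zero =>
      intro c' hn _
      have hall : ∀ j, c' j = 0 := by
        intro j
        have hle : ∑ i, |c' i| ≤ 0 := by exact_mod_cast hn
        have hz := (Finset.sum_eq_zero_iff_of_nonneg fun i _ => abs_nonneg (c' i)).1
          (le_antisymm hle (Finset.sum_nonneg fun i _ => abs_nonneg (c' i))) j (Finset.mem_univ j)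
        exact abs_eq_zero.1 hz
      simp only [hall, Int.cast_zero, zero_mul, Finset.sum_const_zero]
      exact hμ0
    | succ n ih =>
      intro c' hn hc'
      by_cases hle : (∑ j, |c' j|) ≤ n
      · exact ih c' hle hc'
      -- some coordinate is nonzero
      have hpos : ∃ j₀, c' j₀ ≠ 0 := by
        by_contra hall
        push Not at hall
        apply hle
        rw [Finset.sum_eq_zero fun j _ => by rw [hall j, abs_zero]]
        exact_mod_cast Nat.zero_le n
      obtain ⟨j₀, hj₀⟩ := hpos
      -- `s = sign c'_{j₀}`, `c'' = c' - s e_{j₀}`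
      set s : ℤ := Int.sign (c' j₀) with hs
      set c'' : Fin d → ℤ := c' - Pi.single j₀ s with hc''
      have hs1 : s = 1 ∨ s = -1 := by
        rcases lt_or_gt_of_ne hj₀ with h | h
        · right; rw [hs, Int.sign_eq_neg_one_of_neg h]
        · left; rw [hs, Int.sign_eq_one_of_pos h]
      have habs'' : ∀ j, |c'' j| ≤ |c' j| ∧ (j = j₀ → |c'' j| + 1 = |c' j|) := by
        intro j
        rw [hc'', Pi.sub_apply, Pi.single_apply]
        split_ifs with hj
        · subst hj
          rcases lt_or_gt_of_ne hj₀ with h | h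
          · rw [hs, Int.sign_eq_neg_one_of_neg h, abs_of_neg h,
              abs_of_nonpos (by omega : c' j - -1 ≤ 0)]
            exact ⟨by omega, fun _ => by omega⟩
          · rw [hs, Int.sign_eq_one_of_pos h, abs_of_pos h,
              abs_of_nonneg (by omega : 0 ≤ c' j - 1)]
            exact ⟨by omega, fun _ => by omega⟩
        · rw [sub_zero]
          exact ⟨le_rfl, fun h => (hj h).elim⟩
      -- the measure drops by one
      have hsum'' : (∑ j, |c'' j|) ≤ n := by
        have h1 : (∑ j, |c'' j|) + 1 = ∑ j, |c' j| := by
          rw [← Finset.add_sum_erase _ _ (Finset.mem_univ j₀),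
            ← Finset.add_sum_erase _ (fun j => |c' j|) (Finset.mem_univ j₀),
            ← (habs'' j₀).2 rfl]
          have : ∑ x ∈ Finset.univ.erase j₀, |c'' x| = ∑ x ∈ Finset.univ.erase j₀, |c' x| := by
            refine Finset.sum_congr rfl fun j hj => ?_
            rw [hc'', Pi.sub_apply, Pi.single_apply, if_neg (Finset.ne_of_mem_erase hj), sub_zero]
          rw [this]; ring
        have h2 : (∑ j, |c' j|) ≤ n + 1 := by exact_mod_cast hn
        omega
      -- the weight bound persists
      have hcR : ∀ l, (∑ j, |(c'' j : ℝ)| * |(w j l : ℝ)|) < ρ₀ * N := by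
        intro l
        refine lt_of_le_of_lt (Finset.sum_le_sum fun j _ => ?_) (hc' l)
        refine mul_le_mul_of_nonneg_right ?_ (abs_nonneg _)
        have := (habs'' j).1
        rw [← Int.cast_abs, ← Int.cast_abs]
        exact_mod_cast this
      have hIH := ih c'' hsum'' hcR
      -- relate the two combinations: `∑ c' v = ∑ c'' v + s v_{j₀}`
      have hsplit : ∑ j, (c' j : ZMod N) * v j = ∑ j, (c'' j : ZMod N) * v j + (s : ZMod N) * v j₀ := by
        have : ∀ j, (c' j : ZMod N) * v j = (c'' j : ZMod N) * v j +
            ((Pi.single j₀ s : Fin d → ℤ) j : ZMod N) * v j := fun j => by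
          rw [hc'', Pi.sub_apply, Int.cast_sub]; ring
        rw [Finset.sum_congr rfl fun j _ => this j, Finset.sum_add_distrib]
        congr 1
        rw [Finset.sum_eq_single j₀ (fun j _ hj => by rw [Pi.single_apply, if_neg hj]; simp)
          (fun h => (h (Finset.mem_univ _)).elim), Pi.single_eq_same]
      have hsplitμ : ∑ j, (c' j : ZMod N) * μ (v j) =
          ∑ j, (c'' j : ZMod N) * μ (v j) + (s : ZMod N) * μ (v j₀) := by
        have : ∀ j, (c' j : ZMod N) * μ (v j) = (c'' j : ZMod N) * μ (v j) +
            ((Pi.single j₀ s : Fin d → ℤ) j : ZMod N) * μ (v j) := fun j => by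
          rw [hc'', Pi.sub_apply, Int.cast_sub]; ring
        rw [Finset.sum_congr rfl fun j _ => this j, Finset.sum_add_distrib]
        congr 1
        rw [Finset.sum_eq_single j₀ (fun j _ hj => by rw [Pi.single_apply, if_neg hj]; simp)
          (fun h => (h (Finset.mem_univ _)).elim), Pi.single_eq_same]
      -- Bohr membership of `v_{j₀}`: `|w_{j₀ l}| ≤ ∑ |c'_j| |w_{jl}| < ρ₀ N` as `|c'_{j₀}| ≥ 1`
      have hvmem : ∀ l, ‖ZMod.toAddCircle (v j₀ * ξ l)‖ < ρ₀ := by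
        intro l
        have h1 : ‖ZMod.toAddCircle (v j₀ * ξ l)‖ ≤ |(w j₀ l : ℝ)| / N := by
          rw [← hv j₀ l]; exact norm_toAddCircle_intCast_le _
        refine h1.trans_lt ?_
        rw [div_lt_iff₀ hNpos]
        refine lt_of_le_of_lt ?_ (hc' l)
        have hone : (1 : ℝ) ≤ |(c' j₀ : ℝ)| := by
          rw [← Int.cast_abs]
          have : (1 : ℤ) ≤ |c' j₀| := Int.one_le_abs hj₀
          exact_mod_cast this
        calc |(w j₀ l : ℝ)| = 1 * |(w j₀ l : ℝ)| := (one_mul _).symm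
          _ ≤ |(c' j₀ : ℝ)| * |(w j₀ l : ℝ)| := mul_le_mul_of_nonneg_right hone (abs_nonneg _)
          _ ≤ ∑ j, |(c' j : ℝ)| * |(w j l : ℝ)| :=
              Finset.single_le_sum (f := fun j => |(c' j : ℝ)| * |(w j l : ℝ)|)
                (fun j _ => mul_nonneg (abs_nonneg _) (abs_nonneg _)) (Finset.mem_univ j₀)
      rcases hs1 with h1 | h1
      · -- `c'_{j₀} > 0`: apply additivity to `a = ∑ c'' v`, `b = v_{j₀}`
        have ha := hmem c'' hcR
        have hab : ∀ l, ‖ZMod.toAddCircle ((∑ j, (c'' j : ZMod N) * v j + v j₀) * ξ l)‖ < ρ₀ := by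
          intro l
          have := hmem c' hc' l
          rwa [hsplit, h1, Int.cast_one, one_mul] at this
        have hstep := hadd _ _ ha hvmem hab
        rw [hsplit, hsplitμ, h1, Int.cast_one, one_mul, one_mul, hstep, hIH]
      · -- `c'_{j₀} < 0`: apply additivity to `a = ∑ c' v`, `b = v_{j₀}` (`a + b = ∑ c'' v`)
        have ha := hmem c' hc'
        have hab : ∀ l, ‖ZMod.toAddCircle ((∑ j, (c' j : ZMod N) * v j + v j₀) * ξ l)‖ < ρ₀ := by
          intro l
          have := hmem c'' hcR l
          have e : ∑ j, (c'' j : ZMod N) * v j = ∑ j, (c' j : ZMod N) * v j + v j₀ := by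
            rw [hsplit, h1]; push_cast; ring
          rwa [e] at this
        have hstep := hadd _ _ ha hvmem hab
        have e : ∑ j, (c'' j : ZMod N) * v j = ∑ j, (c' j : ZMod N) * v j + v j₀ := by
          rw [hsplit, h1]; push_cast; ring
        rw [e, hstep] at hIH
        have e2 : ∑ j, (c'' j : ZMod N) * μ (v j) = ∑ j, (c' j : ZMod N) * μ (v j) + μ (v j₀) := by
          rw [hsplitμ, h1]; push_cast; ring
        rw [e2] at hIH
        exact add_right_cancel hIH
  -- apply with `n = ∑ |cⱼ|`
  have hn : (∑ j, |c j|) ≤ ((∑ j, |c j|).toNat : ℕ) := Int.self_le_toNat _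
  exact key _ c hn hc

end Summit.Parity.GeneralizedHardyLittlewood.GreenTaoLevelTwoGITwoCyclicInverse
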